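/-
Origin: expansion seat `planner-pub-hodgecm-1-g66-0`, handover #D3 2026-08-20T13:48Z md5 39bd7816abdc (PKG 3c8f2a09697e → 39bd7816abdc; 231 l.; DOC-ONLY: module docstring l.55 «Standing:» rider → the (S6) standing sentence; NAME LIST: none) (`HOME/pub-hodgecm-1-g66/lean/doc52/HodgeCM/StubTree/LineAlbaneseLiu.lean`, md5 39bd7816abdc, 231 lines);
landed by the second packager p2 gen 8 (p2-g8) in gate run 52 REPLACES the earlier landed copy of `HodgeCM/StubTree/LineAlbaneseLiu.lean` (seat copy carried the packager Origin header of an earlier run (stripped)).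
-/
/-
Origin: planner-pub-hodgecm-prl2-g8-0 (unit pub-hodgecm-prl2-g8; EXPANSION prover a-2 "REDUCE, don't construct", generation 8).
Target: HodgeCM/StubTree/LineAlbaneseLiu.lean (NEW additive leaf over this generation's `HodgeCM.StubTree.TypeMatchByName`
and the cited-fact seat's `HodgeCM.Literature.LiuCMData` (cf-kudla-howe-rallis-g7, RUN 31); nothing landed or queued is replaced).
WIP imports `Prl2g8.TypeMatchByName` ↦ `HodgeCM.StubTree.TypeMatchByName`, `CfKHRg7.LiuCMData` ↦ `HodgeCM.Literature.LiuCMData`.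
-/
import Summits.HodgeConjecture.HodgeCM.StubTree.TypeMatchByName
import Summits.HodgeConjecture.HodgeCM.Literature.LiuCMData

/-!
# The Albanese dictionary for lines, handed LITERALLY over Liu's CM data `(M_μ ⊇ M'_μ, η'_μ, det Lie)`

Generation 8, file 2 (strategy 2 "REDUCE, don't construct").  File 1 (`TypeMatchByName`) derived (X4a-i) `BMMDict.TypeMatch`
from the P-IF reading `BMMDict.LineAlbanese`, itself derived (`lineAlbanese_of_det`) from the `M_μ`-level reading
`LineAlbaneseDet`, whose determinant clause `∏_{θ'∈Θ} θ'(x) = ∏_{ψ∈Ψ'} ψ(N_{M/N} x)` was typed over tree CM fields.  This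
file closes the remaining typing distance to print: the reading `BMMDict.LineAlbaneseLiu` hands, for every non-zero line
theta one-form, Liu's datum ITSELF — a `HodgeCM.Literature.Theta.LiuCMData L` (cited-fact seat cf-kudla-howe-rallis-g7,
[Liu21] Def. 4.3 (3) + Def. 4.5: the fields `M_μ ⊇ M'_μ`, the reciprocity map `η'_μ`, the determinant of `i_μ(x)` on
`Lie_E(A_μ)`) — together with
* the VERBATIM printed field `C.Def45_det` ([Liu21] Def. 4.5 (2), first bullet: "the determinant of the action of `i_μ(x)` on
  the `E`-vector space `Lie_E(A_μ)` equals `η_μ(x)`"; existence of such an object = [Liu21] Prop. 4.6 (1), held chunk p0019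
  L1–12 of `paper:arxiv-2102.11518`),
* the two LABELLED linear-algebra readings of that seat, `C.LieEigenReading ι₁ Θf` (the eigencharacters of
  `Lie_E(A_μ) ⊗_{E,ι₁} ℂ` are a finite set `Θf`) and `C.ReflexNormReading ι₁ Sf` (`ι₁ ∘ η'_μ` is the type norm of a finite set
  `Sf` of embeddings of `M'_μ`),
* the statements that `M_μ`, `M'_μ` are CM fields (print: [Liu21] Def. 4.3 (3) "a CM field `M_μ` containing `M'_μ`";
  `M'_μ` is the reflex field of the CM type `(E, Φ_μ)`, and the reflex of a CM-type is a (primitive) CM-type — Shimura,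
  *Abelian Varieties with Complex Multiplication and Modular Functions* (1998) §8.3 Prop. 28, held copy
  `book:shimura1998-abelian-varieties-with-complex-multiplication-modular-functions` p.82 L5–18: "Then `(K*; {ψ_j})` is a
  primitive CM-type"; the CM property is HANDED as the Mathlib class `NumberField.IsCMField`, not derived), and that `Θf`,
  `Sf` underlie CM types `Θ`, `Ψ'` of `M_μ`, `M'_μ`,
* and the Universe-level clause of `LineAlbanese`/`LineAlbaneseDet` (R2/R4 of `ThetaModel.Fact_thetaAlbanese`, node prover 04):
  `Φ = Φ_k(Ψ')` for the reflex embedding `k : M'_μ → L` under `σ'|_{M'_μ} = ι₁ ∘ k`, and the class lies in `U_{(M_μ, Θ, σ')}(Γ)`.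

KERNEL (`lineAlbaneseDet_of_liu` is not even needed — we go straight to the coarse form): `lineAlbanese_of_liu` derives
`LineAlbanese` from `LineAlbaneseLiu` and the model facts M2/M13/M38, BY NAME of the cited-fact seat's
`LiuCMData.cmType_eq_inflate_of_det45` ([Liu21] Def 4.5 (2) + readings ⇒ `Θf = {θ | θ|_{M'_μ} ∈ Sf}`, which rests on node
prover 04's `CMTypeOps.type_eq_inflate_of_det`) and node prover 04's `Universe.Uiso_inflate_le`.  Consequently every
generation-8 end state has a `…Liu`-variant whose dictionary binder quotes [Liu21] Def. 4.5 through the cited-fact seat's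
structure rather than through a tree paraphrase: `typeMatch_of_lineAlbaneseLiu`, `perL_of_liu_bmmByNameLiu`,
`COR_CM_of_liu_bmmByNameLiu_adelic`.

CLASSIFICATION LEDGER (binding rule of the unit: no internally-minted statement enters as a cited fact).
* PRINT, verbatim, typed by the cited-fact seat: `LiuCMData.Def45_det` ([Liu21] Def. 4.5 (2) first bullet, p0018 L53–77).
* P-IF (READINGS, labelled, never citable as facts): `LiuCMData.LieEigenReading`, `LiuCMData.ReflexNormReading` (cf-KHR-g7),
  and the Universe-level clause inherited from `LineAlbanese` (R2/R4 of `Fact_thetaAlbanese`).  `LineAlbaneseLiu` is the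
  conjunction — a P-IF reading with a strictly larger verbatim core than `LineAlbaneseDet`.
* MODEL: M2 `Fact_pull_comp`, M13 `Fact_alphaLine`, M38 `Fact_cmInflation` (node 04's list, `HodgeCM/Geometry/Facts.lean`,
  `PerL34/ThetaSubOfLiu.lean`), consumed by `Uiso_inflate_le`; `UisoRigid` (file 1) where the end states need it.
* KERNEL: everything proved in this file.
Standing: PerL, QW8, N33 and every 2001-programme claim remain NOT cited; printed PerL v5 stands UNREFUTED and UNPROVED (GAPS.md «PROVENANCE ANSWER (coordinator, 2026-08-20)», (S6)) independently.
-/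

set_option autoImplicit false

noncomputable section

open NumberField

namespace HodgeCM

open Literature.AlgebraicGeometry.Motives (CMType)
open CMTypeOps (inflate reflexInflateSet)
open HodgeCM.Literature.Theta (LiuCMData)

namespace Universe

variable {U : Universe}

namespace BMMDict

variable {L : CMField} {ι₁ : L →+* ℂ} {V : HermSpace3 L ι₁} (BD : U.BMMDict V)

/-- **P-IF — the Albanese dictionary for line theta one-forms, handed over Liu's literal CM data.**  For every non-zero
class `θ` of `BD.lineTheta Γ a Φ` there are: Liu's datum `C = (M_μ ⊇ M'_μ, η'_μ, det Lie)` for `(E, Φ_μ) = (L, Φ)`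
([Liu21] Def. 4.3 (3), Def. 4.5, typed by the cited-fact seat as `LiuCMData L`) with `M_μ`, `M'_μ` CM, satisfying the PRINTED
determinant condition `C.Def45_det` ([Liu21] Def. 4.5 (2) first bullet; exists by Prop. 4.6 (1)); finite sets `Θf` (the
eigencharacters of `Lie_E(A_μ) ⊗_{E,ι₁} ℂ`, `C.LieEigenReading ι₁ Θf`) and `Sf` (`ι₁ ∘ η'_μ = ∏_{σ'∈Sf} σ'`,
`C.ReflexNormReading ι₁ Sf`) underlying CM types `Θ` of `M_μ` and `Ψ'` of `M'_μ`; the reflex embedding `k : M'_μ → L`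
(`M'_μ ⊆ ι₁(L)` for `L/ℚ` Galois) and the eigencharacter `σ' : M_μ → ℂ` with `σ'|_{M'_μ} = ι₁ ∘ k` (Liu's `M'_μ ⊆ M_μ ⊂ ℂ`);
the identification `Φ = Φ_k(Ψ')` of the line's type with the reflex-inflated set (R2 of `Fact_thetaAlbanese`); and the
membership `θ ∈ U_{(M_μ, Θ, σ')}(Γ)` (R4: theta one-forms are pulled back from `A_μ` along `Hom(A_K, A_μ)`).
Class: P-IF (a READING around the verbatim core `Def45_det`). -/
def LineAlbaneseLiu : Prop :=
  ∀ (Γ : Level V) (a : L) (Φ : CMType L) (θ : U.CohC (U.pms L ι₁ V Γ) 1), θ ∈ BD.lineTheta Γ a Φ → θ ≠ 0 →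
    ∃ (C : LiuCMData.{0} L) (_ : IsCMField C.M) (_ : IsCMField C.M') (Θf : Finset (C.M →+* ℂ))
      (Sf : Finset (C.M' →+* ℂ)) (Θ : CMType C.M) (Ψ' : CMType C.M') (k : C.M' →+* L) (σ' : C.M →+* ℂ),
      C.Def45_det ∧ C.LieEigenReading ι₁ Θf ∧ C.ReflexNormReading ι₁ Sf ∧ Θ.1 = ↑Θf ∧ Ψ'.1 = ↑Sf ∧
      σ'.comp (algebraMap C.M' C.M) = ι₁.comp k ∧
      Φ.1 = reflexInflateSet (K := CMField.mk C.M') k ι₁ Ψ' ∧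
      θ ∈ U.Uiso Γ (CMField.mk C.M) Θ σ'

/-- **KERNEL**: the Liu-literal reading implies the coarse Albanese dictionary `LineAlbanese` (hence, by file 1, `TypeMatch`
and `SignForcing`).  The CM type `Θ` of `A_μ ⊗_{E,ι₁} ℂ` is the INFLATION of `Ψ'` along `M'_μ ⊆ M_μ` — the cited-fact seat's
`LiuCMData.cmType_eq_inflate_of_det45` ([Liu21] Def. 4.5 (2) + the two readings, on node prover 04's
`CMTypeOps.type_eq_inflate_of_det`) — and the isotypic piece of an inflated type lies in that of the type
(`Universe.Uiso_inflate_le`, node prover 04, from M2 `Fact_pull_comp`, M13 `Fact_alphaLine`, M38 `Fact_cmInflation`). -/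
theorem lineAlbanese_of_liu (h2 : U.Fact_pull_comp) (h13 : U.Fact_alphaLine) (h38 : U.Fact_cmInflation)
    (hA : BD.LineAlbaneseLiu) : BD.LineAlbanese := by
  intro Γ a Φ θ hθ hne
  obtain ⟨C, hM, hN, Θf, Sf, Θ, Ψ', k, σ', h45, hΘf, hSf, hΘ, hΨ, hσ, hΦ, hU⟩ := hA Γ a Φ θ hθ hne
  refine ⟨CMField.mk C.M', k, Ψ', hΦ, ?_⟩
  classical
  have hfin : Θf = Finset.univ.filter (fun θ' : C.M →+* ℂ => θ'.comp (algebraMap C.M' C.M) ∈ Sf) :=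
    C.cmType_eq_inflate_of_det45 h45 hΘf hSf
  have hΘ' : Θ = inflate (K := CMField.mk C.M') (M := CMField.mk C.M) (algebraMap C.M' C.M) Ψ' := by
    refine Subtype.ext (Set.ext fun θ' => ?_)
    change θ' ∈ Θ.1 ↔ θ'.comp (algebraMap C.M' C.M) ∈ Ψ'.1
    rw [hΘ, hΨ, hfin]
    simp
  rw [← hσ]
  rw [hΘ'] at hU
  exact U.Uiso_inflate_le h2 h13 h38 Γ (CMField.mk C.M') (CMField.mk C.M) (algebraMap C.M' C.M) Ψ' σ' hU

/-- (X4a-i) `TypeMatch` from the Liu-literal reading (file 1's `typeMatch_of_lineAlbanese` ∘ `lineAlbanese_of_liu`). -/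
theorem typeMatch_of_lineAlbaneseLiu {T : U.ThetaModel} (hL : IsGalois ℚ L) (hk : T.kappa = SignRecipe.kappa false)
    (h2 : U.Fact_pull_comp) (h13 : U.Fact_alphaLine) (h38 : U.Fact_cmInflation)
    (hR : U.UisoRigid V) (hA : BD.LineAlbaneseLiu) : BD.TypeMatch T :=
  BD.typeMatch_of_lineAlbanese hL hk hR (BD.lineAlbanese_of_liu h2 h13 h38 hA)

end BMMDict

/-! ## The by-name package, Liu-literal form, and the end states -/

/-- **The BMM–glue package BY NAME, Liu-literal form, faces**: file 1's `BMMByNameFace T` with the P-IF reading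
`LineAlbanese` replaced by the Liu-literal reading `LineAlbaneseLiu` (verbatim core [Liu21] Def. 4.5 (2) as
`LiuCMData.Def45_det`).  Every conjunct is P / P-IF / MODEL / DESIGN; none mentions the recipe `κ`. -/
def BMMByNameLiuFace (T : U.ThetaModel) : Prop :=
  ∀ (F : CMField), IsGalois ℚ F → 6 ≤ Module.finrank ℚ F →
    ∀ (f : Face F) (ι₁ : F →+* ℂ), f.Admissible ι₁ → ∀ V : HermSpace3 F ι₁,
      U.UisoDisjoint V ∧ U.UisoRigid V ∧ ∃ BD : U.BMMDict V, BD.Standard T ∧ (∀ Γ, (BD.X Γ).Cor79) ∧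
        BD.Homogeneous ∧ BD.LineAlbaneseLiu ∧ BD.SignMatch T ∧ BD.ThetaOfLine T ∧ BD.LineOfTheta T

/-- The same under the PerL binders. -/
def BMMByNameLiuPerL (T : U.ThetaModel) : Prop :=
  ∀ (K L : CMField) (j : K →+* L), IsNormalClosure ℚ K L →
    Module.finrank ℚ K = 6 → (Module.finrank ℚ L = 24 ∨ Module.finrank ℚ L = 48) →
    ∀ (φ : Fin 3 → (K →+* ℂ)), IsFrame φ →
    ∀ (ι₁ : L →+* ℂ), ι₁.comp j = φ 0 →
    ∀ (t : Fin 4 → CMType K), IsPerLTypes φ t →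
    ∀ V : HermSpace3 L ι₁,
      U.UisoDisjoint V ∧ U.UisoRigid V ∧ ∃ BD : U.BMMDict V, BD.Standard T ∧ (∀ Γ, (BD.X Γ).Cor79) ∧
        BD.Homogeneous ∧ BD.LineAlbaneseLiu ∧ BD.SignMatch T ∧ BD.ThetaOfLine T ∧ BD.LineOfTheta T

namespace ThetaModel

variable {T : U.ThetaModel}

/-- KERNEL: the Liu-literal package implies file 1's by-name package (faces), given M2, M13 (`ModelAxioms`) and M38. -/
theorem bmmByNameFace_of_liu (h2 : U.Fact_pull_comp) (h13 : U.Fact_alphaLine) (h38 : U.Fact_cmInflation)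
    (hX : U.BMMByNameLiuFace T) : U.BMMByNameFace T := by
  intro F hG hdeg f ι₁ hadm V
  obtain ⟨hI, hR, BD, hBD, hB, hHom, hA, hS, hTL, hLT⟩ := hX F hG hdeg f ι₁ hadm V
  exact ⟨hI, hR, BD, hBD, hB, hHom, BD.lineAlbanese_of_liu h2 h13 h38 hA, hS, hTL, hLT⟩

/-- KERNEL: the Liu-literal package implies file 1's by-name package (PerL binders), given M2, M13, M38. -/
theorem bmmByNamePerL_of_liu (h2 : U.Fact_pull_comp) (h13 : U.Fact_alphaLine) (h38 : U.Fact_cmInflation)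
    (hX : U.BMMByNameLiuPerL T) : U.BMMByNamePerL T := by
  intro K L j hN hK hL φ hφ ι₁ hι₁ t ht V
  obtain ⟨hI, hR, BD, hBD, hB, hHom, hA, hS, hTL, hLT⟩ := hX K L j hN hK hL φ hφ ι₁ hι₁ t ht V
  exact ⟨hI, hR, BD, hBD, hB, hHom, BD.lineAlbanese_of_liu h2 h13 h38 hA, hS, hTL, hLT⟩

end ThetaModel

variable (U)

/-- **COR-CM — the lineage's end state, generation 8, Liu-literal form.**  As `COR_CM_of_liu_bmmByName` (file 1) with the
by-name package in its Liu-literal form `BMMByNameLiuFace T` and the extra model fact M38 `Fact_cmInflation`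
(M2 `Fact_pull_comp`, M13 `Fact_alphaLine` are fields of `ModelAxioms`). -/
theorem COR_CM_of_liu_bmmByNameLiu (M : U.ModelAxioms) (h38 : U.Fact_cmInflation) (hV : U.Fact_virtualCup11₂)
    (hL : U.LiuSupplyFace) {T : U.ThetaModel} (h₂ : T.Fact_innerEmb) (h₅ : T.Open_thetaSub)
    (h₇ : T.Open_thetaGen12) (h₈ : T.Open_thetaReal34) (h₉ : T.Open_chars) (h₁₀ : T.Open_occ)
    (hHR : U.Fact_hodgeRiemann20) (hk : T.kappa = SignRecipe.kappa false) (hs : T.Design_frameSignConj)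
    {Hk : U.HeckeData} (hD : U.IsoEmbFace Hk T) (hX : U.BMMByNameLiuFace T)
    (hPo : U.PohlmannSpan) (hQ : U.Qw8Sufficiency) : U.HC_CM :=
  U.COR_CM_of_liu_bmmByName M hV hL h₂ h₅ h₇ h₈ h₉ h₁₀ hHR hk hs hD
    (ThetaModel.bmmByNameFace_of_liu M.pull_comp M.alphaLine h38 hX) hPo hQ

/-- **PerL v5 Thm 4.4 — end state, generation 8, Liu-literal form.** -/
theorem perL44_of_liu_bmmByNameLiu (M : U.ModelAxioms) (h38 : U.Fact_cmInflation) (hV : U.Fact_virtualCup11₂)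
    (hL : U.LiuSupplyPerL) {T : U.ThetaModel} (h₂ : T.Fact_innerEmb) (h₅ : T.Open_thetaSub)
    (h₇ : T.Open_thetaGen12) (h₈ : T.Open_thetaReal34) (h₉ : T.Open_chars) (h₁₀ : T.Open_occ)
    (hHR : U.Fact_hodgeRiemann20) (hk : T.kappa = SignRecipe.kappa false) (hs : T.Design_frameSignConj)
    {Hk : U.HeckeData} (hD : U.IsoEmbPerL Hk T) (hX : U.BMMByNameLiuPerL T) : U.PerL44 :=
  U.perL44_of_liu_bmmByName M hV hL h₂ h₅ h₇ h₈ h₉ h₁₀ hHR hk hs hD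
    (ThetaModel.bmmByNamePerL_of_liu M.pull_comp M.alphaLine h38 hX)

/-- **PerL (`W_per^L`) — end state, generation 8, Liu-literal form.** -/
theorem perL_of_liu_bmmByNameLiu (M : U.ModelAxioms) (h38 : U.Fact_cmInflation) (hV : U.Fact_virtualCup11₂)
    (hL : U.LiuSupplyPerL) {T : U.ThetaModel} (h₂ : T.Fact_innerEmb) (h₅ : T.Open_thetaSub)
    (h₇ : T.Open_thetaGen12) (h₈ : T.Open_thetaReal34) (h₉ : T.Open_chars) (h₁₀ : T.Open_occ)
    (hHR : U.Fact_hodgeRiemann20) (hk : T.kappa = SignRecipe.kappa false) (hs : T.Design_frameSignConj)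
    {Hk : U.HeckeData} (hD : U.IsoEmbPerL Hk T) (hX : U.BMMByNameLiuPerL T) : U.PerL :=
  U.perL_of_liu_bmmByName M hV hL h₂ h₅ h₇ h₈ h₉ h₁₀ hHR hk hs hD
    (ThetaModel.bmmByNamePerL_of_liu M.pull_comp M.alphaLine h38 hX)

/-! ### Junction with strategy 1 (prl1): the constructed theta model at the frame bit `h = false` -/

/-- **COR-CM over strategy 1's constructed theta model `C.thetaModel false d12 d34`, Liu-literal by-name route**: both
design inputs are theorems (`AdelicThetaCore₀.thetaModel_kappa`, `.design_frameSignConj`). -/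
theorem COR_CM_of_liu_bmmByNameLiu_adelic (M : U.ModelAxioms) (h38 : U.Fact_cmInflation)
    (hV : U.Fact_virtualCup11₂) (hL : U.LiuSupplyFace)
    (C : U.AdelicThetaCore₀) (d12 d34 : ∀ {L : CMField}, SeesawCtx L → SideData L)
    (h₂ : (C.thetaModel false d12 d34).Fact_innerEmb) (h₅ : (C.thetaModel false d12 d34).Open_thetaSub)
    (h₇ : (C.thetaModel false d12 d34).Open_thetaGen12) (h₈ : (C.thetaModel false d12 d34).Open_thetaReal34)
    (h₉ : (C.thetaModel false d12 d34).Open_chars) (h₁₀ : (C.thetaModel false d12 d34).Open_occ)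
    (hHR : U.Fact_hodgeRiemann20) {Hk : U.HeckeData} (hD : U.IsoEmbFace Hk (C.thetaModel false d12 d34))
    (hX : U.BMMByNameLiuFace (C.thetaModel false d12 d34)) (hPo : U.PohlmannSpan) (hQ : U.Qw8Sufficiency) :
    U.HC_CM :=
  U.COR_CM_of_liu_bmmByNameLiu M h38 hV hL h₂ h₅ h₇ h₈ h₉ h₁₀ hHR (C.thetaModel_kappa false d12 d34)
    (C.design_frameSignConj false d12 d34) hD hX hPo hQ

/-- **PerL over strategy 1's constructed theta model `C.thetaModel false d12 d34`, Liu-literal by-name route.** -/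
theorem perL_of_liu_bmmByNameLiu_adelic (M : U.ModelAxioms) (h38 : U.Fact_cmInflation)
    (hV : U.Fact_virtualCup11₂) (hL : U.LiuSupplyPerL)
    (C : U.AdelicThetaCore₀) (d12 d34 : ∀ {L : CMField}, SeesawCtx L → SideData L)
    (h₂ : (C.thetaModel false d12 d34).Fact_innerEmb) (h₅ : (C.thetaModel false d12 d34).Open_thetaSub)
    (h₇ : (C.thetaModel false d12 d34).Open_thetaGen12) (h₈ : (C.thetaModel false d12 d34).Open_thetaReal34)
    (h₉ : (C.thetaModel false d12 d34).Open_chars) (h₁₀ : (C.thetaModel false d12 d34).Open_occ)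
    (hHR : U.Fact_hodgeRiemann20) {Hk : U.HeckeData} (hD : U.IsoEmbPerL Hk (C.thetaModel false d12 d34))
    (hX : U.BMMByNameLiuPerL (C.thetaModel false d12 d34)) : U.PerL :=
  U.perL_of_liu_bmmByNameLiu M h38 hV hL h₂ h₅ h₇ h₈ h₉ h₁₀ hHR (C.thetaModel_kappa false d12 d34)
    (C.design_frameSignConj false d12 d34) hD hX

end Universe

end HodgeCM
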